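import Summits.BirchSwinnertonDyer.Rank1Residual.X11b.Three.KolyvaginClassBadPlace
import Literature.NumberTheory.EllipticCurves.RingClassFieldSplitting
import Literature.NumberTheory.NumberFields.ArtinMapDecompositionInertia
import Literature.NumberTheory.NumberFields.UnramifiedCompositum
import Literature.NumberTheory.GaloisRepresentations.DecompositionGroupOfCompletion
import Literature.NumberTheory.EllipticCurves.GeomPointsGaloisModule
import Literature.NumberTheory.EllipticCurves.MatsunoTwistedCurvesPrimesProofs
import Mathlib.NumberTheory.NumberField.Discriminant.Different
import Mathlib.NumberTheory.RamificationInertia.Unramified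
import HarnessLib

/-!
# Route `ErratumRoadFive`, crux `ShimuraKolyvaginOrderBoundInertFromFive` (item
# stmt-BirchSwinnertonDyer-19718) — the bad-place step (R1) at the INERT primes `ℓ ∈ S` (`ℓ ∣ N⁻`,
# in particular `v = p𝓞_K`): Kolyvagin's class of a ring-class-rational point satisfies the Selmer
# local condition there, with NO reduction / component-group / Tate-curve input

Cell `bsd-stepL` (run/shared/lean/pub/bsd-stepL/), seat `bsd-stepL-shim-p1` (prover g6), HELPER for the
crux `Summit.BirchSwinnertonDyer.BirchSwinnertonDyer.Theses.ErratumRoadFive.ShimuraKolyvaginOrderBoundInertFromFive`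
(`--supports stmt-BirchSwinnertonDyer-19718 --as helper`; route `route-BirchSwinnertonDyer-ErratumRoadFive`
rev 19, rung K2; registered skeleton `Cruxes/ShimuraKolyvaginOrderBoundInertFromFive/Lines/birth.lean`
(v2, sha16 df9d5864b1b31f6b): stubs S1 `stub_inert_unitIndex` ∕ S2 `stub_inert_divisibleIndex`, both =
Kolyvagin's theorem for the Heegner point of the Shimura curve `X_{N⁺,N⁻}` at a prime `p ∣ N⁻`).

## What this file proves

The skeleton's docstring names the two unprinted local steps any proof of S1 ∕ S2 must take at the bad
places `v ∣ N` (the cell's reading, `HOME/shim/SHIM-T1-MEMO.md` §7.2–7.3: printed order-bound proofs —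
Kolyvagin, Gross 1991 Prop. 6.2 (1), McCallum 1991 §4, Cha 2005 — treat `v ∣ N` through the cusps of
`X₀(N)` and [GZ86, III (3.1)], which `X_{N⁺,N⁻}` does not have):

* (R1) at `v ∣ ℓ ∣ N⁻` (`ℓ ∈ S`, inert in `K`; this includes `v = p𝓞_K`): `v = ℓ𝓞_K` is principal with
  an integer generator prime to the Kolyvagin conductor `m`, so `v` SPLITS COMPLETELY in the ring class
  field `K[m]` (Howard, Duke Math. J. 124 (2004) Lemma 3.1.5; Gross 1991 §3), hence the whole local Galois
  group `Γ_{K_v}` fixes every `K[m]`-rational point, Kolyvagin's cocycle is locally a coboundary, and the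
  class lies in the Selmer local condition at `v` — with NO hypothesis on the reduction of `E` at `v`;
* (R2) at `v ∣ ℓ ∣ N⁺` (split `ℓ`): Frobenius-coinvariants of the component group (not this file).

THIS FILE makes (R1) a KERNEL THEOREM, in the currency of the tree's general-`p` Kolyvagin machine
(cell `b2b-bsdres`, team x11b3: `Literature/…/HeegnerPointsKolyvaginPrimaryClassesProofs.lean`
(`kolyvaginClass`), `X11b/Three/KolyvaginClassBadPlace.lean` (`GrossBadPlace.cls_mem_resKer_of_vanishing_of_zsmul_mem`),
`X11b/KolyvaginShaOrderOfPoints.lean` (core `KolyvaginOrder.card_sha_primary_le_at_of_pointsM_of_reciprocityFinset_of_localDuality`,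
whose binder `hpoints` asks, for every place `v ∤ m`, exactly
`kolyvaginClass (W.baseChange K) _ hdiv (hA m) (Pt m) (hPt m) ∈ selmerLocalKer (W.baseChange K) (v.adicCompletion K) (p^M)`)):

* §1 `resGal_mem_decompositionSubgroup_adicCompletionPrime`, `resGal_smul_eq_self_of_mem_splitPrimes`,
  `resGal_smul_algHom_eq_self_of_mem_splitPrimes`, `resGal_smul_eq_self_of_mem_splitPrimes_of_forall_fixing`
  — the Galois dictionary: the restriction `res : Γ_{K_v} → Γ_K` (the machine's `resGal`) lands in the
  decomposition group `D_{𝔓₀}` of the prime cut out by the chosen embedding (tree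
  `decompositionSubgroup_adicCompletionPrime_eq_range`, Neukirch II (9.6)), and `D_{𝔓₀}` dies in
  `Gal(F/K)` for every finite Galois `F` in which `v` splits completely (tree
  `absRestrictNormalHom_eq_one_of_mem_splitPrimes_of_mem_stabilizer`, Neukirch I (9.3)); so EVERY
  `σ ∈ Γ_{K_v}` — not only inertia, not only a Frobenius — fixes every embedded copy of `F` and every
  point rational over it.
* §2 `kolyvaginClass_mem_selmerLocalKer_of_forall_resGal_smul_eq` — for an elliptic curve over a number
  field `K`, an admissible `A ≤ E(K̄)`, `P ∈ A` with `(g−1)P ∈ nA`: if `Γ_{K_v}` fixes `P`, Kolyvagin's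
  class `c(P) ∈ H¹(K, E[n])` lies in `selmerLocalKer W K_v n` — Gross's bad-place mechanism
  (`cls_mem_resKer_of_vanishing_of_zsmul_mem`) run with `I = Γ_{K_v}`, receptacle `B = ⊤`, `n′ = 1`: the
  local class is represented by `σ ↦ −(σ−1)P/n = 0`. No reduction type, no component group, no `E⁰`,
  no Milne I.3.8.
* §3 `kolyvaginClass_mem_selmerLocalKer_of_span_natCast_ringClassField` — (R1): `K` imaginary quadratic,
  `K[m] = ringClassField K ι m` (`m ≥ 1`) with a `K`-embedding `e : K[m] → K̄`, a place `v = (ℓ) = ℓ𝓞_K`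
  with `ℓ` prime to `m`, and `P` rational over `e(K[m])` (the machine's `hrat`: every `Φ ∈ Γ_K` fixing
  `e(K[m])` fixes `P` — Gross (4.1) `P_m ∈ E(K_m)`): `c(P) ∈ selmerLocalKer W K_v n`. Inputs: the tree's
  PROVED splitting law `mem_splitPrimes_ringClassField_of_span_natCast` (Cox Thm. 9.2 via global class
  field theory, Deuring, Bauer) + §1 + §2.
* §4 `asIdeal_eq_span_natCast_of_ncard_primesOver_eq_one` — the crux's inert clause
  (`((Ideal.span {(ℓ : ℤ)}).primesOver (𝓞 K)).ncard = 1 ∧ ¬ (ℓ : ℤ) ∣ NumberField.discr K`) gives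
  `v = ℓ𝓞_K` for every place `v ∋ ℓ` (Dedekind's discriminant theorem, Mathlib
  `NumberField.not_dvd_discr_iff_isUnramifiedIn`; tree `QuadraticFieldAux.isPrime_span_of_ncard_eq_one`);
  **`kolyvaginClass_mem_selmerLocalKer_of_mem_inertSet`** — the HEADLINE in the binder shape of item
  19718: for every `ℓ ∈ S` (clause `hin` of the crux verbatim), every place `v` of `K` above `ℓ`, every
  conductor `m ≥ 1` whose prime factors do not divide `N` (Kolyvagin primes: `IsKolyvaginPrime N W K p q`
  carries `¬ q ∣ N`), and every `K[m]`-rational point of an admissible module, Kolyvagin's class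
  satisfies the Selmer condition at `v`. At `ℓ = p ∈ S` this is the inert BSD prime itself: the local
  condition at `v = p𝓞_K`, where `E` has multiplicative reduction AND `v ∣ p`, costs nothing.

## Honest framing

THEOREMS ONLY (no `def`, no named fact, no `sorry`; axioms standard). Nothing here constructs the CM
points of `X_{N⁺,N⁻}` or their norm ∕ congruence ∕ complex-conjugation relations (Nekovář 2007 (4.8),
(4.9), (4.13); Bertolini–Darmon 1996; Cai–Shu–Tian 2014 — the `hCM` ∕ `h37` ∕ `h53` ∕ `hγ` analogues of
the machine's cite-only labels), nor (R2) at `N⁺`, nor the Cassels–Tate inputs of the order form: S1 ∕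
S2 and item 19718 stay OPEN; the crux is K2's imported open input (`tribunal_fit.residual`) and this file
closes a rung leaf of nothing. What moves: the one local step of the Shimura transport that involves the
prime `p ∣ N⁻` (and every other `ℓ ∣ N⁻`) is now a tree theorem stated on the machine's `hpoints`
binder, for ANY Euler-system data rational over ring class fields (`X₀(N)` or `X_{N⁺,N⁻}` alike). BSD is
not proved by any of this; no census number moves.

## References

* [cite: GrossLMS1991, §3 (p. 218 l. 1: "λ splits completely in K_n/K"), §4 (4.1), Prop. 6.2 (1) (pp. 244–245)]
* [cite: McCallumLMS1991, §4 (p. 282 l. 1), Lemma 4.3, Cor. 4.2]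
* [cite: Howard2004Duke, Lemma 3.1.5] (an inert prime not dividing the conductor splits completely in
  the ring class field)
* [cite: NeukirchANT1999, Ch. I §9 Prop. (9.3); Ch. II §9 Prop. (9.6); Ch. III §2 Cor. (2.12)]
* [cite: Cox2013, §9.A Thm. 9.2, §11.A Thm. 11.1]
* [cite: Kim2022HigherGZ, §2.1 and Thm. 4.3] (the printed STATEMENT of the crux; Trans. AMS 2024)
* Cell files: HOME/shim/SHIM-T1-MEMO.md §7.2 (R1)/(R2) (shim-t1 g4, sha16 69aeb969ed11b723), §7.3 transport
  table; HOME/shim/K2-INERT-REKEY-MEMO.md (13a2c97f419b5f25); skeleton v2 df9d5864b1b31f6b.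

## Mathlib / tree search

Tree (reused, not redeclared): `resGal`, `resGal_eq_absGaloisRestrict`, `closureEmb` (`Sha`,
`GeomPointsGaloisModule`); `adicCompletionPrime`, `adicCompletionPrime_mem_primesAbove`,
`decompositionSubgroup_adicCompletionPrime_eq_range` (`DecompositionGroupOfCompletion`);
`absRestrictNormalHom_eq_one_of_mem_splitPrimes_of_mem_stabilizer` (`ArtinMapDecompositionInertia`);
`absRestrictNormalHom_eq_one_iff_forall_smul` (`UnramifiedCompositum`); `splitPrimes_congr`;
`GrossBadPlace.cls_mem_resKer_of_vanishing_of_zsmul_mem` (`X11b/Three/KolyvaginClassBadPlace`);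
`kolyvaginClass`, `selmerLocalKer`, `pointsMap`, `pointsMap_smul`, `oneCocycleClass_zero`;
`mem_splitPrimes_ringClassField_of_span_natCast`, `finiteDimensional_and_isGalois_ringClassField`
(`RingClassFieldSplitting`, `HeegnerPointsOfConductor`); `QuadraticFieldAux.isPrime_span_of_ncard_eq_one`
(`MatsunoTwistedCurvesPrimesProofs`). Mathlib: `NumberField.not_dvd_discr_iff_isUnramifiedIn`,
`Algebra.IsUnramifiedIn.ramificationIdx_eq_one`, `Ideal.ramificationIdxIn_eq_ramificationIdx`,
`Ideal.liesOver_span_iff`, `AlgEquiv.ofInjectiveField`, `IsGalois.of_algEquiv`.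
`lean search 'resGal_smul_eq_self_of_mem_splitPrimes|kolyvaginClass_mem_selmerLocalKer_of_forall|of_mem_inertSet'`
→ no matches (the inertia-only twin is `KolyvaginH44.resGal_smul_algHom_ringClassField_eq_self`,
`X11b/KolyvaginPointInertia`).
-/

noncomputable section

open scoped Classical
open scoped AddSubgroup

set_option linter.dupNamespace false

namespace Summit.BirchSwinnertonDyer.BirchSwinnertonDyer.Theorems

open WeierstrassCurve NumberField IsDedekindDomain Field
  Literature.NumberTheory.EllipticCurves Literature.NumberTheory.EllipticCurves.KolyvaginCocycle
  Literature.NumberTheory.GaloisRepresentations Literature.NumberTheory.NumberFields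
  Summit.BirchSwinnertonDyer.Rank1Residual.X11b.Three.GrossBadPlace

variable {K : Type} [Field K] [NumberField K]

/-! ### §1 Complete splitting: the local Galois group fixes the field -/

/-- **`res(Γ_{K_v}) ⊆ D_{𝔓₀}`.** For a finite place `v` of the number field `K`, the machine's
restriction `resGal : Γ_{K_v} → Γ_K` (along the chosen embedding `K̄ → K̄_v`; `= absGaloisRestrict`,
tree `resGal_eq_absGaloisRestrict`) takes every `σ ∈ Γ_{K_v}` into the decomposition group of the prime
`𝔓₀ = adicCompletionPrime K v` of `\bar ℤ_K` cut out by that embedding (tree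
`decompositionSubgroup_adicCompletionPrime_eq_range`: `D_{𝔓₀} = res(Γ_{K_v})`).
[cite: NeukirchANT1999, Ch. II §9 Prop. (9.6)] -/
theorem resGal_mem_decompositionSubgroup_adicCompletionPrime (v : HeightOneSpectrum (𝓞 K))
    (σ : absoluteGaloisGroup (v.adicCompletion K)) :
    resGal (K := K) (v.adicCompletion K) σ ∈
      (adicCompletionPrime K v).decompositionSubgroup (absoluteGaloisGroup K) := by
  rw [decompositionSubgroup_adicCompletionPrime_eq_range, resGal_eq_absGaloisRestrict]
  exact ⟨σ, rfl⟩

/-- **At a completely split place the whole local Galois group fixes the field.** If `v` splits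
completely in the finite Galois `E ⊆ K̄`, then for EVERY `σ ∈ Γ_{K_v}` (not only inertia, not only a
Frobenius) and every `x ∈ E`: `res(σ) • x = x` — `res(σ) ∈ D_{𝔓₀}` and the decomposition groups above a
completely split prime die in `Gal(E/K)` (tree `absRestrictNormalHom_eq_one_of_mem_splitPrimes_of_mem_stabilizer`,
`#D = e·f = 1`). [cite: NeukirchANT1999, Ch. I §9 Prop. (9.3) and Ch. II §9 Prop. (9.6)] -/
theorem resGal_smul_eq_self_of_mem_splitPrimes (E : IntermediateField K (AlgebraicClosure K))
    [FiniteDimensional K E] [IsGalois K E] {v : HeightOneSpectrum (𝓞 K)}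
    (hv : v ∈ splitPrimes K E) (σ : absoluteGaloisGroup (v.adicCompletion K))
    {x : AlgebraicClosure K} (hx : x ∈ E) :
    resGal (K := K) (v.adicCompletion K) σ • x = x := by
  have h1 := absRestrictNormalHom_eq_one_of_mem_splitPrimes_of_mem_stabilizer E hv
    (adicCompletionPrime_mem_primesAbove K v)
    (resGal_mem_decompositionSubgroup_adicCompletionPrime v σ)
  exact (absRestrictNormalHom_eq_one_iff_forall_smul E _).mp h1 ⟨x, hx⟩

/-- **Embedded form.** For an abstract finite Galois number field `F/K`, a `K`-embedding `e : F → K̄` and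
a place `v` of `K` splitting completely in `F`: `res(σ) • e x = e x` for every `σ ∈ Γ_{K_v}` and every
`x ∈ F` (apply `resGal_smul_eq_self_of_mem_splitPrimes` to the image `e(F) ⊆ K̄`, `K`-isomorphic to `F`).
[cite: NeukirchANT1999, Ch. I §9 Prop. (9.3) and Ch. II §9 Prop. (9.6)] -/
theorem resGal_smul_algHom_eq_self_of_mem_splitPrimes {F : Type*} [Field F] [NumberField F]
    [Algebra K F] [IsGalois K F] (e : F →ₐ[K] AlgebraicClosure K) {v : HeightOneSpectrum (𝓞 K)}
    (hv : v ∈ splitPrimes K F) (σ : absoluteGaloisGroup (v.adicCompletion K)) (x : F) :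
    resGal (K := K) (v.adicCompletion K) σ • e x = e x := by
  set ε : F ≃ₐ[K] e.fieldRange :=
    (show F ≃ₐ[K] e.fieldRange from AlgEquiv.ofInjectiveField e) with hεdef
  haveI : FiniteDimensional K e.fieldRange := LinearEquiv.finiteDimensional ε.toLinearEquiv
  haveI : IsGalois K e.fieldRange := IsGalois.of_algEquiv ε
  haveI : NumberField e.fieldRange := NumberField.of_module_finite K e.fieldRange
  have hv' : v ∈ splitPrimes K e.fieldRange := by
    rw [← Literature.NumberTheory.NumberFields.splitPrimes_congr ε]
    exact hv
  exact resGal_smul_eq_self_of_mem_splitPrimes e.fieldRange hv' σ ⟨x, rfl⟩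

/-- **A point rational over the embedded field is fixed by the whole local Galois group.** With `F`,
`e`, `v` as in `resGal_smul_algHom_eq_self_of_mem_splitPrimes` and any `Γ_K`-set `X`: if every
`Φ ∈ Γ_K` fixing `e(F)` pointwise fixes `P ∈ X` (the machine's rationality datum `hrat`, Gross 1991 (4.1)
"`P_n ∈ E(K_n)`"), then `res(σ) • P = P` for every `σ ∈ Γ_{K_v}`.
[cite: GrossLMS1991, §4 (4.1)] [cite: NeukirchANT1999, Ch. II §9 Prop. (9.6)] -/
theorem resGal_smul_eq_self_of_mem_splitPrimes_of_forall_fixing {F : Type*} [Field F]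
    [NumberField F] [Algebra K F] [IsGalois K F] (e : F →ₐ[K] AlgebraicClosure K)
    {v : HeightOneSpectrum (𝓞 K)} (hv : v ∈ splitPrimes K F)
    {X : Type*} [MulAction (absoluteGaloisGroup K) X] {P : X}
    (hrat : ∀ Φ : absoluteGaloisGroup K, (∀ x : F, Φ • e x = e x) → Φ • P = P)
    (σ : absoluteGaloisGroup (v.adicCompletion K)) :
    resGal (K := K) (v.adicCompletion K) σ • P = P :=
  hrat _ fun x ↦ resGal_smul_algHom_eq_self_of_mem_splitPrimes e hv σ x

/-! ### §2 A class fixed by the whole local Galois group is locally trivial -/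

/-- **A Kolyvagin class fixed by the whole local Galois group satisfies the Selmer condition.** Let
`E/K` be an elliptic curve over a number field, `A ≤ E(K̄)` admissible for `n` (`Γ_K`-stable, `[n]`
injective on `A`; printed `A = E(K_n)`, `n = p^M`), `P ∈ A` with `(g−1)P ∈ nA` for all `g ∈ Γ_K`, and
`c(P) ∈ H¹(K, E[n])` Kolyvagin's class (McCallum's cocycle `g ↦ g(P/n) − P/n − (g−1)P/n`). If every
`σ ∈ Γ_{K_v}` fixes `P`, then `c(P) ∈ selmerLocalKer W K_v n` ("`d(n)_v = 0`"): the image of `c(P)` in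
`H¹(K_v, E)` is the class of `σ ↦ −((res σ − 1)P)/n = 0` (McCallum Cor. 4.2; Gross's mechanism
`GrossBadPlace.cls_mem_resKer_of_vanishing_of_zsmul_mem` with `I = Γ_{K_v}`, `B = ⊤`, `n′ = 1`). NO
hypothesis on the reduction of `E` at `v`. [cite: McCallumLMS1991, Cor. 4.2, Lemma 4.3]
[cite: GrossLMS1991, Prop. 6.2 (1)] -/
theorem kolyvaginClass_mem_selmerLocalKer_of_forall_resGal_smul_eq
    (W : WeierstrassCurve K) {n : ℤ}
    {hdiv : ∀ P : geomPoints W, ∃ Q : geomPoints W, n • Q = P}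
    {A : AddSubgroup (geomPoints W)}
    (hA : IsAdmissible (absoluteGaloisGroup K) A n) {P : geomPoints W}
    (hP : P ∈ invPoints (absoluteGaloisGroup K) A n) (v : HeightOneSpectrum (𝓞 K))
    (hfix : ∀ σ : absoluteGaloisGroup (v.adicCompletion K),
      resGal (K := K) (v.adicCompletion K) σ • P = P) :
    kolyvaginClass W n hdiv hA P hP ∈ selmerLocalKer W (v.adicCompletion K) n :=
  cls_mem_resKer_of_vanishing_of_zsmul_mem (resGal (K := K) (v.adicCompletion K))
    (pointsMap W (v.adicCompletion K)) (pointsMap_smul W (v.adicCompletion K)) hA _ hP _ _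
    (I := Set.univ) (fun σ _ ↦ hfix σ) ⊤ isCoprime_one_right (fun _ ↦ AddSubgroup.mem_top _)
    (fun f _ hf ↦ by
      have h0 : f = 0 := Subtype.ext (ContinuousMap.ext fun σ ↦ hf σ (Set.mem_univ σ))
      rw [h0]
      exact oneCocycleClass_zero _)

/-! ### §3 The ring class field: every place `(ℓ)`, `ℓ` prime to the conductor -/

/-- **(R1) — the Selmer condition at a place `(ℓ) = ℓ𝓞_K`, `ℓ` prime to the conductor, for points
rational over the ring class field.** `K` imaginary quadratic, `ι : K → ℂ`, `m ≥ 1`,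
`K[m] = ringClassField K ι m` with a `K`-embedding `e : K[m] → K̄`; `v` a place of `K` with
`v = (ℓ) = ℓ𝓞_K` for a natural number `ℓ` prime to `m` (every rational prime inert in `K` and prime to
`m`; in the crux: every `ℓ ∈ S`, in particular `ℓ = p`); `E/K` an elliptic curve, `A ≤ E(K̄)` admissible,
`P ∈ A` with `(g−1)P ∈ nA`, rational over `e(K[m])` (`hrat`). Then Kolyvagin's class `c(P)` satisfies
the Selmer local condition at `v`. Proof: `v` splits completely in `K[m]` (tree
`mem_splitPrimes_ringClassField_of_span_natCast` — Cox Thm. 9.2 ∕ Gross §3 ∕ Howard L3.1.5, PROVED from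
global class field theory), so `Γ_{K_v}` fixes `P` (§1) and the class is locally trivial (§2). The printed
`X₀(N)` argument at a bad place (Gross Prop. 6.2 (1) via [GZ86 III (3.1)]) is not needed here.
[cite: Howard2004Duke, Lemma 3.1.5] [cite: GrossLMS1991, §3 (p. 218), Prop. 6.2 (1)]
[cite: Cox2013, §9.A Thm. 9.2] -/
theorem kolyvaginClass_mem_selmerLocalKer_of_span_natCast_ringClassField
    (hK : IsImaginaryQuadratic K) (ι : K →+* ℂ) {m : ℕ} (hm : m ≠ 0)
    (e : ringClassField K ι m →ₐ[K] AlgebraicClosure K)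
    {v : HeightOneSpectrum (𝓞 K)} {ℓ : ℕ} (hvℓ : v.asIdeal = Ideal.span {((ℓ : ℕ) : 𝓞 K)})
    (hℓ : Nat.Coprime ℓ m)
    (W : WeierstrassCurve K) {n : ℤ}
    {hdiv : ∀ P : geomPoints W, ∃ Q : geomPoints W, n • Q = P}
    {A : AddSubgroup (geomPoints W)}
    (hA : IsAdmissible (absoluteGaloisGroup K) A n) {P : geomPoints W}
    (hP : P ∈ invPoints (absoluteGaloisGroup K) A n)
    (hrat : ∀ Φ : absoluteGaloisGroup K,
      (∀ x : ringClassField K ι m, Φ • e x = e x) → Φ • P = P) :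
    kolyvaginClass W n hdiv hA P hP ∈ selmerLocalKer W (v.adicCompletion K) n := by
  haveI := (finiteDimensional_and_isGalois_ringClassField hK ι hm).1
  haveI := (finiteDimensional_and_isGalois_ringClassField hK ι hm).2
  haveI : NumberField (ringClassField K ι m) := NumberField.of_module_finite K _
  have hvs : v ∈ splitPrimes K (ringClassField K ι m) :=
    mem_splitPrimes_ringClassField_of_span_natCast hK ι hm hvℓ hℓ
  exact kolyvaginClass_mem_selmerLocalKer_of_forall_resGal_smul_eq W hA hP v
    (resGal_smul_eq_self_of_mem_splitPrimes_of_forall_fixing e hvs hrat)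

/-! ### §4 The inert set `S` of the crux: every place of `K` above `ℓ ∈ S` is `(ℓ) = ℓ𝓞_K` -/

/-- **The crux's inert clause pins the place: `v = ℓ𝓞_K`.** For `K` imaginary quadratic and a rational
prime `ℓ` with exactly one prime of `𝓞 K` above it and `ℓ ∤ d_K` (the clause
`((Ideal.span {(ℓ : ℤ)}).primesOver (𝓞 K)).ncard = 1 ∧ ¬ (ℓ : ℤ) ∣ NumberField.discr K` of item 19718),
every place `v ∋ ℓ` of `K` is `v = (ℓ) = ℓ𝓞_K`: `ℓ` is unramified (Dedekind, Mathlib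
`NumberField.not_dvd_discr_iff_isUnramifiedIn`), so `e(v|ℓ) = 1`, and `ℓ𝓞_K = v^{e} = v` (tree
`QuadraticFieldAux.isPrime_span_of_ncard_eq_one`). [cite: NeukirchANT1999, Ch. III §2 Cor. (2.12)] -/
theorem asIdeal_eq_span_natCast_of_ncard_primesOver_eq_one (hK : IsImaginaryQuadratic K)
    {ℓ : ℕ} (hℓ : ℓ.Prime) (hg : ((Ideal.span {(ℓ : ℤ)}).primesOver (𝓞 K)).ncard = 1)
    (hd : ¬ (ℓ : ℤ) ∣ NumberField.discr K) {v : HeightOneSpectrum (𝓞 K)}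
    (hv : ((ℓ : ℕ) : 𝓞 K) ∈ v.asIdeal) :
    v.asIdeal = Ideal.span {((ℓ : ℕ) : 𝓞 K)} := by
  haveI : Algebra.IsQuadraticExtension ℚ K := { finrank_eq_two' := hK.1 }
  haveI : IsGalois ℚ K := inferInstance
  have hp : Prime (ℓ : ℤ) := Nat.prime_iff_prime_int.mp hℓ
  have hunr : Algebra.IsUnramifiedIn (𝓞 K) (Ideal.span {(ℓ : ℤ)}) :=
    (NumberField.not_dvd_discr_iff_isUnramifiedIn K (𝓞 K) hp).mp hd
  have hv' : ((ℓ : ℤ) : 𝓞 K) ∈ v.asIdeal := by exact_mod_cast hv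
  haveI : v.asIdeal.LiesOver (Ideal.span {(ℓ : ℤ)}) :=
    (Ideal.liesOver_span_iff v.isPrime.ne_top hp).mpr hv'
  have he1 : v.asIdeal.ramificationIdx ℤ = 1 := hunr.ramificationIdx_eq_one ‹_›
  have he : (Ideal.span {(ℓ : ℤ)}).ramificationIdxIn (𝓞 K) = 1 := by
    rw [Ideal.ramificationIdxIn_eq_ramificationIdx (Ideal.span {(ℓ : ℤ)}) v.asIdeal (K ≃ₐ[ℚ] K)]
    exact he1
  have hprime : (Ideal.span ({((ℓ : ℕ) : 𝓞 K)} : Set (𝓞 K))).IsPrime :=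
    QuadraticFieldAux.isPrime_span_of_ncard_eq_one hℓ he hg
  have hle : Ideal.span {((ℓ : ℕ) : 𝓞 K)} ≤ v.asIdeal :=
    (Ideal.span_singleton_le_iff_mem _).mpr hv
  have hne : Ideal.span ({((ℓ : ℕ) : 𝓞 K)} : Set (𝓞 K)) ≠ ⊥ := by
    rw [Ne, Ideal.span_singleton_eq_bot]
    exact_mod_cast hℓ.ne_zero
  exact ((hprime.isMaximal hne).eq_of_le v.isPrime.ne_top hle).symm

/-- **(R1) in the binder shape of item 19718 — the Selmer condition at EVERY place above the inert set
`S`, for every Kolyvagin conductor.** `K` imaginary quadratic, `S` with the crux's clause `hin` VERBATIM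
(`∀ ℓ ∈ S, ℓ.Prime ∧ ℓ ∣ N ∧ ¬ ℓ² ∣ N ∧ #primesOver = 1 ∧ ℓ ∤ d_K`), `m ≥ 1` with no prime factor dividing
`N` (products of Kolyvagin primes: `IsKolyvaginPrime N W K p q` carries `¬ q ∣ N`), `K[m]` with a
`K`-embedding `e`, `ℓ ∈ S`, `v` any place of `K` above `ℓ`, and `P` a point of an admissible module
rational over `e(K[m])`: Kolyvagin's class `c(P)` lies in `selmerLocalKer W K_v n`. This is the clause
`∀ v, (m : 𝓞 K) ∉ v.asIdeal → kolyvaginClass … ∈ selmerLocalKer …` of the machine's `hpoints` binder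
(`KolyvaginOrder.card_sha_primary_le_at_of_pointsM_of_reciprocityFinset_of_localDuality`) at the places
`v ∣ N⁻ = ∏ S` — including `v = p𝓞_K` for the BSD prime `p ∈ S` — for ANY Euler-system data over ring
class fields; the reading (R1) of HOME/shim/SHIM-T1-MEMO.md §7.2 as a theorem. HONEST: S1 ∕ S2 of the
skeleton and item 19718 stay open (the CM points of `X_{N⁺,N⁻}`, their Euler-system relations, (R2) at
`N⁺` and the global argument are not here). [cite: Howard2004Duke, Lemma 3.1.5]
[cite: GrossLMS1991, §4 (4.1), Prop. 6.2 (1)] [cite: Kim2022HigherGZ, §2.1 and Thm. 4.3] -/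
theorem kolyvaginClass_mem_selmerLocalKer_of_mem_inertSet
    (hK : IsImaginaryQuadratic K) (ι : K →+* ℂ) {m : ℕ} (hm : m ≠ 0)
    (e : ringClassField K ι m →ₐ[K] AlgebraicClosure K)
    {N : ℕ} {S : Finset ℕ}
    (hin : ∀ ℓ ∈ S, ℓ.Prime ∧ ℓ ∣ N ∧ ¬ ℓ ^ 2 ∣ N ∧
      ((Ideal.span {(ℓ : ℤ)}).primesOver (𝓞 K)).ncard = 1 ∧ ¬ (ℓ : ℤ) ∣ NumberField.discr K)
    (hmN : ∀ q ∈ m.primeFactors, ¬ q ∣ N)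
    {ℓ : ℕ} (hℓS : ℓ ∈ S) {v : HeightOneSpectrum (𝓞 K)} (hv : ((ℓ : ℕ) : 𝓞 K) ∈ v.asIdeal)
    (W : WeierstrassCurve K) {n : ℤ}
    {hdiv : ∀ P : geomPoints W, ∃ Q : geomPoints W, n • Q = P}
    {A : AddSubgroup (geomPoints W)}
    (hA : IsAdmissible (absoluteGaloisGroup K) A n) {P : geomPoints W}
    (hP : P ∈ invPoints (absoluteGaloisGroup K) A n)
    (hrat : ∀ Φ : absoluteGaloisGroup K,
      (∀ x : ringClassField K ι m, Φ • e x = e x) → Φ • P = P) :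
    kolyvaginClass W n hdiv hA P hP ∈ selmerLocalKer W (v.adicCompletion K) n := by
  obtain ⟨hℓ, hℓN, -, hg, hd⟩ := hin ℓ hℓS
  have hℓm : Nat.Coprime ℓ m := by
    refine (Nat.Prime.coprime_iff_not_dvd hℓ).mpr fun h ↦ ?_
    exact hmN ℓ (Nat.mem_primeFactors.mpr ⟨hℓ, h, hm⟩) hℓN
  exact kolyvaginClass_mem_selmerLocalKer_of_span_natCast_ringClassField hK ι hm e
    (asIdeal_eq_span_natCast_of_ncard_primesOver_eq_one hK hℓ hg hd hv) hℓm W hA hP hrat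

end Summit.BirchSwinnertonDyer.BirchSwinnertonDyer.Theorems

end
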